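import Summits.HodgeConjecture.HodgeConjecture.Theorems.Ring2AbelianAllAndreRelativeCorrespondences
import Summits.HodgeConjecture.HodgeConjecture.Theorems.Ring2AbelianAllAndreFibreClassSupportNoGo
import HarnessLib

/-!
# Ring 2 · sub-cell AbelianAll (ALL ABELIAN VARIETIES), André axis, part XVI-d — THE BASE IMAGE OF A WITNESS IS
# TWO-DIMENSIONAL: a correspondence `(a, b)_* w` on `𝒳 × 𝒳` whose base pair `(a ≫ f, b ≫ f) : W → S × S` factors
# through a CURVE (the diagonal, a Hecke curve, `{s₀} × S`, `S × {t₀}`, …) never witnesses a clause of the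
# fibre-class Lefschetz node (β′_f). Kernel form of ALL THREE items of part XV-a's print dictionary (AA2.52).

HONEST FRAMING (page 1, verbatim): **research route, not a corollary; conditional on HC_CM plus one named
minimal statement.** Cell line: research route conditional on HC_CM; not a corollary; Q11.4-sentence-2
already refuted in dim ≥ 3. Nothing in this file proves a case of the Hodge conjecture for an abelian variety.
`HC_CM` = `Theses.RankFourFaces.CMAbelianHodge` does not occur in this file; item `Theses.RankFourFaces.CMToAbelian`
(stmt-16267) OPEN and not closed here. Seat `pub-hodge-ring2-ab-andre-2`, gen 8 (parts XVI-c + XV-a/d combined).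

## What is proved (theorems only; no definition, no named fact, no sorry; every input a tree theorem)

Throughout `f : 𝒳 ⟶ S` is a compact pencil of abelian `d`-folds, `W` (resp. `V`) a smooth projective variety,
`a, b : W ⟶ 𝒳`, `w ∈ H^q(W(ℂ); ℂ)`, `μ` an orientation family with Poincaré duality,
`γ = (a, b)_* w ∈ H^{2e}((𝒳 ⊗ 𝒳)(ℂ); ℂ)` and `T = γ^* = pr_{1*}(pr₂^*(·) ∪ γ)` (Voisin II (10.7), read in the
orientations of `μ`), `[𝒳_t] = j_{t*} 1` the fibre class.

§1 **`corrClassAction_complexGysin_lift` — the action of a push-forward correspondence: `[(a, b)_* w]^*(c) =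
a_*(b^* c ∪ w)`** (general smooth projective `V → W × X`; projection formula `complexGysin_cup`, functoriality
`complexGysin_comp`; with `w = 1` the familiar `Γ^* = a_* b^*`, cf. the tree's `corrClassAction_graph`).

§2 **First-vertical in cohomology** (`a^*[𝒳_t] = 0`, e.g. `a` factors through a fibre `𝒳_{s₀}`: the cycle lies in
`𝒳_{s₀} × 𝒳`): `map_fiberι_complexGysin_eq_zero_of_map_fiberClass_eq_zero` — `j_s^*(a_* z) = 0` for every `z` and
`s` (projection formula `a_* z ∪ [𝒳_s] = a_*(z ∪ a^*[𝒳_s]) = 0`, then the KERNEL IDENTITY (κ)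
`fibreGysinKernelOn_holds`: `j_{s*} j_s^* y = 0 ⟹ j_s^* y = 0`, a tree theorem); hence `j_s^* ∘ T = 0` and
`not_fibreClassLefschetz_clause_of_map_fst_fiberClass_eq_zero`.

§3 **Second-vertical in cohomology** (`b^*[𝒳_t] = 0`: the cycle lies in `𝒳 × 𝒳_{t₀}`): `T(j_{t*} j_t^* W) =
a_*(b^* W ∪ b^*[𝒳_t] ∪ w) = 0` (`corrClassAction_lift_fiberGysin_eq_zero_of_map_snd_fiberClass_eq_zero`), hence
`not_fibreClassLefschetz_clause_of_map_snd_fiberClass_eq_zero`.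

§4 **Proportional** (`b^*[𝒳_t] = c • a^*[𝒳_t]`): `γ` is PROPORTIONALLY BALANCED, `γ ∪ pr₂^*[𝒳_t] =
c • (γ ∪ pr₁^*[𝒳_t])` (`cupProduct_complexGysin_lift_snd_eq_smul`), excluded by part XV-d
(`not_fibreClassLefschetz_clause_of_map_fiberClass_propor`); and `a^*[𝒳_t] = c • b^*[𝒳_t]` likewise
(`…_propor'`: `c = 0` is §2, `c ≠ 0` is the previous case with `c⁻¹`).

§5 **CORRESPONDENCES OVER A CURVE OF `S × S` ARE EXCLUDED** (`not_fibreClassLefschetz_clause_of_factor_curve`): if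
`(a ≫ f, b ≫ f)` factors as `W —g→ C ⇉_{u,v} S` through a smooth projective CURVE `C`, then `a^*[𝒳_t] = g^* u^* σ_t`,
`b^*[𝒳_t] = g^* v^* σ_t` (part XVI-c: `[𝒳_t] = f^* σ_t`) with `u^* σ_t, v^* σ_t` in the LINE `H²(C(ℂ); ℂ)`, so §2 or
§4 applies: **`T` never witnesses a clause `p ≤ d` of `FibreClassLefschetzOn hf`.** Cases by name: the DIAGONAL /
relative correspondences (`C = S`, `u = v = 𝟙`; part XVI-c), HECKE-type correspondences (`C → S × S` any pair of
maps), and cycles over `{s₀} × S` or `S × {t₀}`.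

READING (RING2-MAP §AbelianAll gen 8). Part XV-a's conclusion "every algebraic witness of a clause of (β′_f) has
an irreducible component DOMINATING `S × S`" was a print deduction (Fulton 19.1 / Ex. 10.3.2); it is now a
KERNEL THEOREM in the form: no class `(a,b)_* w` with `(a ≫ f, b ≫ f)` factoring through a smooth projective
curve is a witness — so a witness class, written as a sum of push-forwards from resolutions of the components
of a cycle, has a component whose base pair `W → S × S` does not factor through a curve, i.e. (W irreducible)
is DOMINANT. For the W₆ find-the-cycle problem (AA2.52): the sought codimension-6 cycle on the 14-fold `𝒳 × 𝒳`
is a genuinely 2-parameter family `{z_{s,t} ⊂ 𝒳_s × 𝒳_t}_{(s,t) ∈ S × S}` of 6-cycles. No named fact; no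
Hodge-conjecture input; `HC_CM` does not occur.

References: VoisinHodgeII2003 (proof of Thm. 10.17 (10.7)); FultonYoungTableaux1997 (App. B §B.1 (2), (4)–(6));
Fulton1998 (§16.1, §19.1 Prop. 19.1.1, Example 10.3.2); DeligneHodgeII1971 (Thm. 4.1.1 (κ)); Andre1996Motifs
(§2.1 p. 14–15, Prop. 3.3 p. 21); Abdulali1994FamiliesAV (Conj. 5.3, Thm. 5.5 p. 1130); HatcherAT2002 (§3.2
Prop. 3.10, §3.3 Thm. 3.26); DeningerMurre1991 (Thm. 3.1); Kunnemann1993 (§3).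
-/

noncomputable section

set_option linter.dupNamespace false

namespace Summit.HodgeConjecture.HodgeConjecture.Ring2.AbelianAll

open CategoryTheory AlgebraicGeometry MonoidalCategory CartesianMonoidalCategory
open Literature.AlgebraicGeometry Literature.AlgebraicGeometry.Motives
open Literature.AlgebraicGeometry.HodgeTheory
open Literature.AlgebraicTopology.SingularHomology (singularCohomology cupProduct cupProduct_gradedComm_holds
  HomologicalOrientation)

/-! ## §1 The action of a push-forward correspondence: `[(a, b)_* w]^* c = a_*(b^* c ∪ w)` -/

section Action

variable {l m n : ℕ} {V W X : SchemeOver ℂ}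

/-- **`[(a, b)_* w]^*(c) = a_*(b^* c ∪ w)`.** For smooth projective `V`, `W`, `X` of dimensions `l`, `m`, `n`,
`a : V ⟶ W`, `b : V ⟶ X`, an orientation family `μ` with Poincaré duality, `w ∈ H^q(V(ℂ))` and
`γ = (a, b)_* w ∈ H^{2e}((W ⊗ X)(ℂ))`, the correspondence action `γ^*(c) = pr_{W*}(pr_X^* c ∪ γ)` (read in the
orientations of `μ`) is `a_*(b^* c ∪ w)`: `pr_X^* c ∪ (a,b)_* w = (a,b)_*((a,b)^* pr_X^* c ∪ w) = (a,b)_*(b^* c ∪ w)`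
(projection formula) and `pr_{W*} ∘ (a,b)_* = a_*`. With `w = 1` this is `Γ^* = a_* b^*`.
[cite: VoisinHodgeII2003, proof of Thm. 10.17 (10.7)] [cite: FultonYoungTableaux1997, Appendix B §B.1 (2), (5), (6)]
[cite: Fulton1998, §16.1] -/
theorem corrClassAction_complexGysin_lift (μ : OrientationFamily) (hμ : μ.HasPoincareDuality)
    (hV : IsSmoothProjective l V) (hW : IsSmoothProjective m W)
    (hWX : IsSmoothProjective (m + n) (W ⊗ X)) (a : V ⟶ W) (b : V ⟶ X)
    {q e a' b' q' : ℕ} (hqe : q + 2 * (m + n) = 2 * e + 2 * l) (hab : a' + 2 * e = b' + 2 * n)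
    (hq' : b' + q' = 2 * m) (haq : a' + q + 2 * m = b' + 2 * l) (w : complexBetti V q) (c : complexBetti X a') :
    corrClassAction (μ hWX) (μ hW) hab hq' (complexGysin μ hV hWX (lift a b) hqe w) c =
      complexGysin μ hV hW a haq (cupProduct rfl (complexBetti.map b a' c) w) := by
  rw [corrClassAction_apply,
    ← complexGysin_eq_gysinMap hWX hW (fst W X) (show a' + 2 * e + 2 * m = b' + 2 * (m + n) by omega),
    ← complexGysin_cup hμ hV hWX (lift a b) (rfl : a' + q = a' + q)
      (show a' + q + 2 * (m + n) = (a' + 2 * e) + 2 * l by omega) hqe rfl]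
  have hgs : complexBetti.map (lift a b) a' (complexBetti.map (snd W X) a' c) = complexBetti.map b a' c := by
    rw [← CategoryTheory.comp_apply, ← complexBetti.map_comp, lift_snd]
  rw [hgs]
  have hcomp := complexGysin_comp hμ hV hWX hW (lift a b) (fst W X)
    (show a' + q + 2 * (m + n) = (a' + 2 * e) + 2 * l by omega)
    (show a' + 2 * e + 2 * m = b' + 2 * (m + n) by omega)
  rw [lift_fst] at hcomp
  have h := LinearMap.congr_fun hcomp (cupProduct rfl (complexBetti.map b a' c) w)
  rw [LinearMap.comp_apply] at h
  exact h.symm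

end Action

variable {𝒳 S : SchemeOver ℂ} {m : ℕ} {W : SchemeOver ℂ}

/-! ## §2 First-vertical in cohomology: `a^*[𝒳_t] = 0` ⟹ `j_s^* ∘ a_* = 0` ⟹ no witness -/

/-- **`a^*[𝒳_{t₀}] = 0` ⟹ `j_s^*(a_* z) = 0` for every class `z` on `W` and every fibre `s`**: by the projection
formula `j_{s*} j_s^*(a_* z) = a_* z ∪ [𝒳_s] = [𝒳_{t₀}] ∪ a_* z = a_*(a^*[𝒳_{t₀}] ∪ z) = 0` ((φ): `[𝒳_s] = [𝒳_{t₀}]`),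
and the KERNEL IDENTITY (κ) `fibreGysinKernelOn_holds` (Deligne; a tree theorem) gives `j_s^*(a_* z) = 0`.
[cite: DeligneHodgeII1971, Thm. 4.1.1] [cite: FultonYoungTableaux1997, Appendix B §B.1 (6)] -/
theorem map_fiberι_complexGysin_eq_zero_of_map_fiberClass_eq_zero {d : ℕ} {f : 𝒳 ⟶ S}
    (hf : IsCompactAbelianPencil f d) (hW : IsSmoothProjective m W) (a : W ⟶ 𝒳) (μ : OrientationFamily)
    (hμ : μ.HasPoincareDuality) {t₀ : ComplexPoints S}
    (ha0 : complexBetti.map a (2 * (0 + 1))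
      (fiberGysin hf t₀ 0 (singularCohomology.one ℂ (ComplexPoints (fiberOver f t₀)))) = 0)
    {k p : ℕ} (hk : k + 2 * (d + 1) = 2 * p + 2 * m) (z : complexBetti W k) (s : ComplexPoints S) :
    complexBetti.map (fiberι f s) (2 * p) (complexGysin μ hW hf.isSmoothProjective_total a hk z) = 0 := by
  refine fibreGysinKernelOn_holds hf p s s _ ?_
  rw [fiberGysin_map_fiberι_eq_cupProduct hf s, fibreClassConstantOn_holds hf s t₀,
    cupProduct_gradedComm_holds ℂ _ (show 2 * p + 2 * (0 + 1) = 2 * (p + 1) by ring)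
      (show 2 * (0 + 1) + 2 * p = 2 * (p + 1) by ring),
    ← complexGysin_cup hμ hW hf.isSmoothProjective_total a (rfl : 2 * (0 + 1) + k = 2 * (0 + 1) + k)
      (show 2 * (0 + 1) + k + 2 * (d + 1) = 2 * (p + 1) + 2 * m by omega) hk
      (show 2 * (0 + 1) + 2 * p = 2 * (p + 1) by ring),
    ha0, map_zero, LinearMap.zero_apply, map_zero, smul_zero]

/-- **First-vertical no-go**: if `a^*[𝒳_{t₀}] = 0` (in print: the cycle lies over `{s₀} × S`, `a` factoring
through the fibre `𝒳_{s₀}`), then for `γ = (a, b)_* w` and `T = γ^*`, `j_s^* ∘ T = 0`, so `T` never witnesses a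
clause `p ≤ d` of (β′_f) (`j_{t₀}^* ≠ 0` on `H²ᵖ(𝒳)`, `exists_map_fiberι_ne_zero`).
[cite: Abdulali1994FamiliesAV, Conjecture 5.3 and Theorem 5.5 (p. 1130)] [cite: DeligneHodgeII1971, Thm. 4.1.1] -/
theorem not_fibreClassLefschetz_clause_of_map_fst_fiberClass_eq_zero {d : ℕ} {f : 𝒳 ⟶ S}
    (hf : IsCompactAbelianPencil f d) (hW : IsSmoothProjective m W) (a b : W ⟶ 𝒳) (μ : OrientationFamily)
    (hμ : μ.HasPoincareDuality) {q e : ℕ} (hqe : q + 2 * ((d + 1) + (d + 1)) = 2 * e + 2 * m)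
    (w : complexBetti W q) {t₀ : ComplexPoints S}
    (ha0 : complexBetti.map a (2 * (0 + 1))
      (fiberGysin hf t₀ 0 (singularCohomology.one ℂ (ComplexPoints (fiberOver f t₀)))) = 0)
    {p q' : ℕ} (hpe : 2 * (p + 1) + 2 * e = 2 * p + 2 * (d + 1)) (hq' : 2 * p + q' = 2 * (d + 1)) (hp : p ≤ d) :
    ¬ ∀ (W' : complexBetti 𝒳 (2 * p)) (t s : ComplexPoints S),
        complexBetti.map (fiberι f s) (2 * p)
          (corrClassAction (μ (hf.isSmoothProjective_total.tensor_holds hf.isSmoothProjective_total))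
            (μ hf.isSmoothProjective_total) hpe hq'
            (complexGysin μ hW (hf.isSmoothProjective_total.tensor_holds hf.isSmoothProjective_total)
              (lift a b) hqe w)
            (fiberGysin hf t p (complexBetti.map (fiberι f t) (2 * p) W'))) =
          complexBetti.map (fiberι f s) (2 * p) W' := by
  have h𝒳 := hf.isSmoothProjective_total
  intro h
  obtain ⟨W', hW'⟩ := exists_map_fiberι_ne_zero hf hp t₀
  apply hW'
  rw [← h W' t₀ t₀, corrClassAction_complexGysin_lift μ hμ hW h𝒳 (h𝒳.tensor_holds h𝒳) a b hqe hpe hq'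
    (show 2 * (p + 1) + q + 2 * (d + 1) = 2 * p + 2 * m by omega)]
  exact map_fiberι_complexGysin_eq_zero_of_map_fiberClass_eq_zero hf hW a μ hμ ha0 _ _ t₀

/-! ## §3 Second-vertical in cohomology: `b^*[𝒳_t] = 0` ⟹ `T ∘ L_t = 0` ⟹ no witness -/

/-- **`b^*[𝒳_{t₀}] = 0` ⟹ `T(j_{t*} j_t^* W) = 0`**: `T(W ∪ [𝒳_t]) = a_*(b^*(W ∪ [𝒳_{t₀}]) ∪ w) =
a_*((b^* W ∪ b^*[𝒳_{t₀}]) ∪ w) = 0`. [cite: VoisinHodgeII2003, proof of Thm. 10.17 (10.7)] [cite: HatcherAT2002, §3.2 Prop. 3.10] -/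
theorem corrClassAction_lift_fiberGysin_eq_zero_of_map_snd_fiberClass_eq_zero {d : ℕ} {f : 𝒳 ⟶ S}
    (hf : IsCompactAbelianPencil f d) (hW : IsSmoothProjective m W) (a b : W ⟶ 𝒳) (μ : OrientationFamily)
    (hμ : μ.HasPoincareDuality) {q e : ℕ} (hqe : q + 2 * ((d + 1) + (d + 1)) = 2 * e + 2 * m)
    (w : complexBetti W q) {t₀ : ComplexPoints S}
    (hb0 : complexBetti.map b (2 * (0 + 1))
      (fiberGysin hf t₀ 0 (singularCohomology.one ℂ (ComplexPoints (fiberOver f t₀)))) = 0)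
    {p q' : ℕ} (hpe : 2 * (p + 1) + 2 * e = 2 * p + 2 * (d + 1)) (hq' : 2 * p + q' = 2 * (d + 1))
    (W' : complexBetti 𝒳 (2 * p)) (t : ComplexPoints S) :
    corrClassAction (μ (hf.isSmoothProjective_total.tensor_holds hf.isSmoothProjective_total))
        (μ hf.isSmoothProjective_total) hpe hq'
        (complexGysin μ hW (hf.isSmoothProjective_total.tensor_holds hf.isSmoothProjective_total) (lift a b) hqe w)
        (fiberGysin hf t p (complexBetti.map (fiberι f t) (2 * p) W')) = 0 := by
  have h𝒳 := hf.isSmoothProjective_total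
  rw [corrClassAction_complexGysin_lift μ hμ hW h𝒳 (h𝒳.tensor_holds h𝒳) a b hqe hpe hq'
      (show 2 * (p + 1) + q + 2 * (d + 1) = 2 * p + 2 * m by omega),
    fiberGysin_map_fiberι_eq_cupProduct hf t W', fibreClassConstantOn_holds hf t t₀, complexBetti.map_cupProduct,
    hb0, map_zero, map_zero, LinearMap.zero_apply, map_zero]

/-- **Second-vertical no-go**: if `b^*[𝒳_{t₀}] = 0` (the cycle lies over `S × {t₀}`), `T = [(a, b)_* w]^*` kills
`j_{t*} j_t^* W` for all `W`, `t`, so it never witnesses a clause `p ≤ d` of (β′_f).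
[cite: Abdulali1994FamiliesAV, Conjecture 5.3 and Theorem 5.5 (p. 1130)] -/
theorem not_fibreClassLefschetz_clause_of_map_snd_fiberClass_eq_zero {d : ℕ} {f : 𝒳 ⟶ S}
    (hf : IsCompactAbelianPencil f d) (hW : IsSmoothProjective m W) (a b : W ⟶ 𝒳) (μ : OrientationFamily)
    (hμ : μ.HasPoincareDuality) {q e : ℕ} (hqe : q + 2 * ((d + 1) + (d + 1)) = 2 * e + 2 * m)
    (w : complexBetti W q) {t₀ : ComplexPoints S}
    (hb0 : complexBetti.map b (2 * (0 + 1))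
      (fiberGysin hf t₀ 0 (singularCohomology.one ℂ (ComplexPoints (fiberOver f t₀)))) = 0)
    {p q' : ℕ} (hpe : 2 * (p + 1) + 2 * e = 2 * p + 2 * (d + 1)) (hq' : 2 * p + q' = 2 * (d + 1)) (hp : p ≤ d) :
    ¬ ∀ (W' : complexBetti 𝒳 (2 * p)) (t s : ComplexPoints S),
        complexBetti.map (fiberι f s) (2 * p)
          (corrClassAction (μ (hf.isSmoothProjective_total.tensor_holds hf.isSmoothProjective_total))
            (μ hf.isSmoothProjective_total) hpe hq'
            (complexGysin μ hW (hf.isSmoothProjective_total.tensor_holds hf.isSmoothProjective_total)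
              (lift a b) hqe w)
            (fiberGysin hf t p (complexBetti.map (fiberι f t) (2 * p) W'))) =
          complexBetti.map (fiberι f s) (2 * p) W' := by
  intro h
  obtain ⟨W', hW'⟩ := exists_map_fiberι_ne_zero hf hp t₀
  apply hW'
  rw [← h W' t₀ t₀,
    corrClassAction_lift_fiberGysin_eq_zero_of_map_snd_fiberClass_eq_zero hf hW a b μ hμ hqe w hb0 hpe hq' W' t₀,
    map_zero]

/-! ## §4 Proportional fibre classes ⟹ proportionally balanced ⟹ no witness -/

/-- **`b^*[𝒳_{t₀}] = c • a^*[𝒳_{t₀}]` ⟹ `γ ∪ pr₂^*[𝒳_{t₀}] = c • (γ ∪ pr₁^*[𝒳_{t₀}])`** for `γ = (a, b)_* w`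
(projection formula, as in part XVI-c §3). [cite: FultonYoungTableaux1997, Appendix B §B.1 (4)–(6)] [cite: Fulton1998, Example 10.3.2] -/
theorem cupProduct_complexGysin_lift_snd_eq_smul {d : ℕ} {f : 𝒳 ⟶ S} (hf : IsCompactAbelianPencil f d)
    (hW : IsSmoothProjective m W) (a b : W ⟶ 𝒳) (μ : OrientationFamily) (hμ : μ.HasPoincareDuality)
    {q e : ℕ} (hqe : q + 2 * ((d + 1) + (d + 1)) = 2 * e + 2 * m) (w : complexBetti W q) {t₀ : ComplexPoints S}
    {c : ℂ} (hc : complexBetti.map b (2 * (0 + 1))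
        (fiberGysin hf t₀ 0 (singularCohomology.one ℂ (ComplexPoints (fiberOver f t₀)))) =
      c • complexBetti.map a (2 * (0 + 1))
        (fiberGysin hf t₀ 0 (singularCohomology.one ℂ (ComplexPoints (fiberOver f t₀))))) :
    cupProduct (Nat.add_comm (2 * e) (2 * (0 + 1)))
        (complexGysin μ hW (hf.isSmoothProjective_total.tensor_holds hf.isSmoothProjective_total) (lift a b) hqe w)
        (complexBetti.map (snd 𝒳 𝒳) (2 * (0 + 1))
          (fiberGysin hf t₀ 0 (singularCohomology.one ℂ (ComplexPoints (fiberOver f t₀))))) =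
      c • cupProduct (Nat.add_comm (2 * e) (2 * (0 + 1)))
        (complexGysin μ hW (hf.isSmoothProjective_total.tensor_holds hf.isSmoothProjective_total) (lift a b) hqe w)
        (complexBetti.map (fst 𝒳 𝒳) (2 * (0 + 1))
          (fiberGysin hf t₀ 0 (singularCohomology.one ℂ (ComplexPoints (fiberOver f t₀))))) := by
  have h𝒳 := hf.isSmoothProjective_total
  have hXX := h𝒳.tensor_holds h𝒳
  set F := fiberGysin hf t₀ 0 (singularCohomology.one ℂ (ComplexPoints (fiberOver f t₀))) with hF
  have h2 : complexBetti.map (lift a b) (2 * (0 + 1)) (complexBetti.map (snd 𝒳 𝒳) (2 * (0 + 1)) F) =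
      complexBetti.map b (2 * (0 + 1)) F := by
    rw [← CategoryTheory.comp_apply, ← complexBetti.map_comp, lift_snd]
  have h1 : complexBetti.map (lift a b) (2 * (0 + 1)) (complexBetti.map (fst 𝒳 𝒳) (2 * (0 + 1)) F) =
      complexBetti.map a (2 * (0 + 1)) F := by
    rw [← CategoryTheory.comp_apply, ← complexBetti.map_comp, lift_fst]
  rw [cupProduct_gradedComm_holds ℂ _ (Nat.add_comm (2 * e) (2 * (0 + 1))) rfl _
      (complexBetti.map (snd 𝒳 𝒳) (2 * (0 + 1)) F),
    cupProduct_gradedComm_holds ℂ _ (Nat.add_comm (2 * e) (2 * (0 + 1))) rfl _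
      (complexBetti.map (fst 𝒳 𝒳) (2 * (0 + 1)) F),
    ← complexGysin_cup hμ hW hXX (lift a b) (rfl : 2 * (0 + 1) + q = 2 * (0 + 1) + q)
      (show 2 * (0 + 1) + q + 2 * ((d + 1) + (d + 1)) = (2 * (0 + 1) + 2 * e) + 2 * m by omega) hqe rfl,
    ← complexGysin_cup hμ hW hXX (lift a b) (rfl : 2 * (0 + 1) + q = 2 * (0 + 1) + q)
      (show 2 * (0 + 1) + q + 2 * ((d + 1) + (d + 1)) = (2 * (0 + 1) + 2 * e) + 2 * m by omega) hqe rfl,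
    h2, h1, hc, LinearMap.map_smul₂, map_smul, smul_comm]

/-- **Proportional no-go**: if `b^*[𝒳_{t₀}] = c • a^*[𝒳_{t₀}]` then `γ = (a, b)_* w` is proportionally balanced
and (part XV-d, `not_fibreClassLefschetz_clause_of_propBalanced`) `γ^*` never witnesses a clause `p ≤ d` of
(β′_f). In print: cycles over a curve of `S × S` finite over the first factor. [cite: Abdulali1994FamiliesAV, Conjecture 5.3 (p. 1130)]
[cite: Fulton1998, Example 10.3.2] -/
theorem not_fibreClassLefschetz_clause_of_map_fiberClass_propor {d : ℕ} {f : 𝒳 ⟶ S}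
    (hf : IsCompactAbelianPencil f d) (hW : IsSmoothProjective m W) (a b : W ⟶ 𝒳) (μ : OrientationFamily)
    (hμ : μ.HasPoincareDuality) {q e : ℕ} (hqe : q + 2 * ((d + 1) + (d + 1)) = 2 * e + 2 * m)
    (w : complexBetti W q) {t₀ : ComplexPoints S} {c : ℂ}
    (hc : complexBetti.map b (2 * (0 + 1))
        (fiberGysin hf t₀ 0 (singularCohomology.one ℂ (ComplexPoints (fiberOver f t₀)))) =
      c • complexBetti.map a (2 * (0 + 1))
        (fiberGysin hf t₀ 0 (singularCohomology.one ℂ (ComplexPoints (fiberOver f t₀)))))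
    {p q' : ℕ} (hpe : 2 * (p + 1) + 2 * e = 2 * p + 2 * (d + 1)) (hq' : 2 * p + q' = 2 * (d + 1)) (hp : p ≤ d) :
    ¬ ∀ (W' : complexBetti 𝒳 (2 * p)) (t s : ComplexPoints S),
        complexBetti.map (fiberι f s) (2 * p)
          (corrClassAction (μ (hf.isSmoothProjective_total.tensor_holds hf.isSmoothProjective_total))
            (μ hf.isSmoothProjective_total) hpe hq'
            (complexGysin μ hW (hf.isSmoothProjective_total.tensor_holds hf.isSmoothProjective_total)
              (lift a b) hqe w)
            (fiberGysin hf t p (complexBetti.map (fiberι f t) (2 * p) W'))) =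
          complexBetti.map (fiberι f s) (2 * p) W' :=
  not_fibreClassLefschetz_clause_of_propBalanced hf _ _ (hμ hf.isSmoothProjective_total) hpe hq' _ t₀ t₀ c
    (cupProduct_complexGysin_lift_snd_eq_smul hf hW a b μ hμ hqe w hc) hp

/-- The same with the roles exchanged: `a^*[𝒳_{t₀}] = c • b^*[𝒳_{t₀}]` (`c = 0`: §2; `c ≠ 0`: the previous theorem
with `c⁻¹`). In print: cycles over a curve of `S × S` finite over the second factor. [cite: Abdulali1994FamiliesAV, Conjecture 5.3 (p. 1130)]
[cite: Fulton1998, Example 10.3.2] -/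
theorem not_fibreClassLefschetz_clause_of_map_fiberClass_propor' {d : ℕ} {f : 𝒳 ⟶ S}
    (hf : IsCompactAbelianPencil f d) (hW : IsSmoothProjective m W) (a b : W ⟶ 𝒳) (μ : OrientationFamily)
    (hμ : μ.HasPoincareDuality) {q e : ℕ} (hqe : q + 2 * ((d + 1) + (d + 1)) = 2 * e + 2 * m)
    (w : complexBetti W q) {t₀ : ComplexPoints S} {c : ℂ}
    (hc : complexBetti.map a (2 * (0 + 1))
        (fiberGysin hf t₀ 0 (singularCohomology.one ℂ (ComplexPoints (fiberOver f t₀)))) =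
      c • complexBetti.map b (2 * (0 + 1))
        (fiberGysin hf t₀ 0 (singularCohomology.one ℂ (ComplexPoints (fiberOver f t₀)))))
    {p q' : ℕ} (hpe : 2 * (p + 1) + 2 * e = 2 * p + 2 * (d + 1)) (hq' : 2 * p + q' = 2 * (d + 1)) (hp : p ≤ d) :
    ¬ ∀ (W' : complexBetti 𝒳 (2 * p)) (t s : ComplexPoints S),
        complexBetti.map (fiberι f s) (2 * p)
          (corrClassAction (μ (hf.isSmoothProjective_total.tensor_holds hf.isSmoothProjective_total))
            (μ hf.isSmoothProjective_total) hpe hq'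
            (complexGysin μ hW (hf.isSmoothProjective_total.tensor_holds hf.isSmoothProjective_total)
              (lift a b) hqe w)
            (fiberGysin hf t p (complexBetti.map (fiberι f t) (2 * p) W'))) =
          complexBetti.map (fiberι f s) (2 * p) W' := by
  by_cases hc0 : c = 0
  · rw [hc0, zero_smul] at hc
    exact not_fibreClassLefschetz_clause_of_map_fst_fiberClass_eq_zero hf hW a b μ hμ hqe w hc hpe hq' hp
  · refine not_fibreClassLefschetz_clause_of_map_fiberClass_propor hf hW a b μ hμ hqe w (t₀ := t₀) (c := c⁻¹) ?_
      hpe hq' hp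
    rw [hc, smul_smul, inv_mul_cancel₀ hc0, one_smul]

/-! ## §5 Correspondences over a curve of `S × S` are excluded -/

/-- **THE BASE IMAGE OF A WITNESS IS TWO-DIMENSIONAL.** Let `f : 𝒳 ⟶ S` be a compact pencil of abelian
`d`-folds, `W` smooth projective, `a, b : W ⟶ 𝒳`, and suppose the base pair `(a ≫ f, b ≫ f)` factors through a
smooth projective CURVE: `a ≫ f = g ≫ u`, `b ≫ f = g ≫ v` for some `g : W ⟶ C`, `u, v : C ⟶ S`. Then for every
class `w` on `W`, every orientation family `μ` with Poincaré duality and every degree `p ≤ d`, the correspondence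
action `T = [(a, b)_* w]^*` is NOT a witness of the degree-`p` clause of (β′_f): it is false that
`j_s^*(T(j_{t*} j_t^* W)) = j_s^* W` for all `W, t, s`. Proof: `[𝒳_t] = f^* σ_t` (part XVI-c), so
`a^*[𝒳_t] = g^*(u^* σ_t)`, `b^*[𝒳_t] = g^*(v^* σ_t)` with `u^* σ_t`, `v^* σ_t` in the line `H²(C(ℂ); ℂ)`: either
`u^* σ_t = 0` (§2) or `v^* σ_t = c • u^* σ_t` (§4). Covers the diagonal (relative correspondences of the abelian
scheme: part XVI-c), Hecke-type correspondences over a curve `C → S × S`, and cycles over `{s₀} × S`, `S × {t₀}`.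
[cite: Abdulali1994FamiliesAV, Conjecture 5.3 and Theorem 5.5 (p. 1130)] [cite: Fulton1998, §19.1 Prop. 19.1.1 and Example 10.3.2]
[cite: Andre1996Motifs, §2.1 (p. 14) and Prop. 3.3 (p. 21)] [cite: DeningerMurre1991, Thm. 3.1] -/
theorem not_fibreClassLefschetz_clause_of_factor_curve {d : ℕ} {f : 𝒳 ⟶ S} (hf : IsCompactAbelianPencil f d)
    (hW : IsSmoothProjective m W) (a b : W ⟶ 𝒳) {C : SchemeOver ℂ} (hC : IsSmoothProjective 1 C)
    (g : W ⟶ C) (u v : C ⟶ S) (hau : a ≫ f = g ≫ u) (hbv : b ≫ f = g ≫ v)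
    (μ : OrientationFamily) (hμ : μ.HasPoincareDuality)
    {q e : ℕ} (hqe : q + 2 * ((d + 1) + (d + 1)) = 2 * e + 2 * m) (w : complexBetti W q)
    {p q' : ℕ} (hpe : 2 * (p + 1) + 2 * e = 2 * p + 2 * (d + 1)) (hq' : 2 * p + q' = 2 * (d + 1)) (hp : p ≤ d) :
    ¬ ∀ (W' : complexBetti 𝒳 (2 * p)) (t s : ComplexPoints S),
        complexBetti.map (fiberι f s) (2 * p)
          (corrClassAction (μ (hf.isSmoothProjective_total.tensor_holds hf.isSmoothProjective_total))
            (μ hf.isSmoothProjective_total) hpe hq'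
            (complexGysin μ hW (hf.isSmoothProjective_total.tensor_holds hf.isSmoothProjective_total)
              (lift a b) hqe w)
            (fiberGysin hf t p (complexBetti.map (fiberι f t) (2 * p) W'))) =
          complexBetti.map (fiberι f s) (2 * p) W' := by
  -- a point of the base
  obtain ⟨t₀⟩ : Nonempty (ComplexPoints S) := by
    haveI : IsIntegral S.left := IsSmoothProjective.isIntegral_holds hf.isSmoothProjective_base
    haveI : SmoothOfRelativeDimension 1 S.hom := hf.isSmoothProjective_base.smoothOfRelativeDimension
    haveI : Infinite (ComplexPoints S) := Motives.infinite_algPoints S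
    infer_instance
  -- `[𝒳_{t₀}] = f^* σ`
  obtain ⟨σ, hσ⟩ := exists_fiberClass_eq_map_base hf t₀
  have ha : complexBetti.map a (2 * (0 + 1))
      (fiberGysin hf t₀ 0 (singularCohomology.one ℂ (ComplexPoints (fiberOver f t₀)))) =
      complexBetti.map g (2 * (0 + 1)) (complexBetti.map u (2 * (0 + 1)) σ) := by
    rw [hσ, ← CategoryTheory.comp_apply, ← complexBetti.map_comp, hau, complexBetti.map_comp,
      CategoryTheory.comp_apply]
  have hb : complexBetti.map b (2 * (0 + 1))
      (fiberGysin hf t₀ 0 (singularCohomology.one ℂ (ComplexPoints (fiberOver f t₀)))) =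
      complexBetti.map g (2 * (0 + 1)) (complexBetti.map v (2 * (0 + 1)) σ) := by
    rw [hσ, ← CategoryTheory.comp_apply, ← complexBetti.map_comp, hbv, complexBetti.map_comp,
      CategoryTheory.comp_apply]
  by_cases hu : complexBetti.map u (2 * (0 + 1)) σ = 0
  · -- first-vertical
    refine not_fibreClassLefschetz_clause_of_map_fst_fiberClass_eq_zero hf hW a b μ hμ hqe w (t₀ := t₀) ?_
      hpe hq' hp
    rw [ha, hu, map_zero]
  · -- `H²(C)` is a line: `v^* σ = c • u^* σ`
    obtain ⟨c, hc⟩ := exists_eq_smul_of_top complexOrientationFamily hC hu (complexBetti.map v (2 * (0 + 1)) σ)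
    refine not_fibreClassLefschetz_clause_of_map_fiberClass_propor hf hW a b μ hμ hqe w (t₀ := t₀) (c := c) ?_
      hpe hq' hp
    rw [hb, hc, map_smul, ← ha]

/-- **Relative correspondences (the diagonal case `C = S`, `u = v = 𝟙`)** — part XVI-c's no-go recovered from §5.
[cite: DeningerMurre1991, Thm. 3.1] [cite: Kunnemann1993, §3] -/
theorem not_fibreClassLefschetz_clause_of_comp_eq' {d : ℕ} {f : 𝒳 ⟶ S} (hf : IsCompactAbelianPencil f d)
    (hW : IsSmoothProjective m W) (a b : W ⟶ 𝒳) (hab : a ≫ f = b ≫ f)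
    (μ : OrientationFamily) (hμ : μ.HasPoincareDuality)
    {q e : ℕ} (hqe : q + 2 * ((d + 1) + (d + 1)) = 2 * e + 2 * m) (w : complexBetti W q)
    {p q' : ℕ} (hpe : 2 * (p + 1) + 2 * e = 2 * p + 2 * (d + 1)) (hq' : 2 * p + q' = 2 * (d + 1)) (hp : p ≤ d) :
    ¬ ∀ (W' : complexBetti 𝒳 (2 * p)) (t s : ComplexPoints S),
        complexBetti.map (fiberι f s) (2 * p)
          (corrClassAction (μ (hf.isSmoothProjective_total.tensor_holds hf.isSmoothProjective_total))
            (μ hf.isSmoothProjective_total) hpe hq'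
            (complexGysin μ hW (hf.isSmoothProjective_total.tensor_holds hf.isSmoothProjective_total)
              (lift a b) hqe w)
            (fiberGysin hf t p (complexBetti.map (fiberι f t) (2 * p) W'))) =
          complexBetti.map (fiberι f s) (2 * p) W' :=
  not_fibreClassLefschetz_clause_of_factor_curve hf hW a b hf.isSmoothProjective_base (a ≫ f) (𝟙 S) (𝟙 S)
    (by rw [Category.comp_id]) (by rw [Category.comp_id, hab]) μ hμ hqe w hpe hq' hp

end Summit.HodgeConjecture.HodgeConjecture.Ring2.AbelianAll

end
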